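import Literature.MathematicalPhysics.QuantumFieldTheory.ConformalBootstrap3D.PointKernelK34L505Data
import Literature.MathematicalPhysics.QuantumFieldTheory.ConformalBootstrap3D.PointKernelK34L505Segs
import Literature.MathematicalPhysics.QuantumFieldTheory.ConformalBootstrap3D.PointKernelParts

/-!
# K34L505 certificate, kernel part file P54: one-cell head segments 119, 120, 121 in level ranges

The head cells whose kernel evaluation exceeds one `decide` are one-cell segments of `hsegsK34L505`; each is
checked by `PCert.hPartSideOK` (side conditions) and `PCert.hPartOK` per level range `[n_lo, n_lo + count)`
against an integer claim, the claims summing to `≥ 0` (`PointKernel.partsOK`); soundness is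
`PCert.hParts_sound` (`PointKernelParts`).  The part files are mutually independent (each imports only
the data file); the ranges of one cell may span several of them, and the per-cell conclusions
`hparts_i` / `hcell_i` of those cells are assembled in `PointKernelK34L505.lean`.
Estimated kernel time 257 s.
-/

set_option maxRecDepth 100000
set_option maxHeartbeats 0

namespace Literature.MathematicalPhysics.QuantumFieldTheory.ConformalBootstrap3D.PointKernelK34L505

open Literature.MathematicalPhysics.QuantumFieldTheory.ConformalBootstrap3D.PointKernel

/-- levels `[0, 31)` of segment 119: partial lower sum `≥` claim. [folklore] -/
theorem part_119_0 : certK34L505.hPartOK (PCert.segAt hsegsK34L505 119) JHK34L505 0 31 (-11037173248942104616881523624906422388) = true := by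
  decide +kernel

/-- levels `[31, 44)` of segment 119: partial lower sum `≥` claim. [folklore] -/
theorem part_119_1 : certK34L505.hPartOK (PCert.segAt hsegsK34L505 119) JHK34L505 31 13 (10128208013632687268971323987383014251) = true := by
  decide +kernel

/-- levels `[44, 49)` of segment 119: partial lower sum `≥` claim. [folklore] -/
theorem part_119_2 : certK34L505.hPartOK (PCert.segAt hsegsK34L505 119) JHK34L505 44 5 (908965235309417347910199637523408137) = true := by
  decide +kernel

/-- one-cell segment 120 (row 6, cell `[451/64, 903/128]`, chord, `n_F = 40`,
2 level ranges): side conditions. [folklore] -/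
theorem pside_120 : certK34L505.hPartSideOK (PCert.segAt hsegsK34L505 120) JHK34L505 = true := by
  decide +kernel

/-- its level ranges `(n_lo, count, claim)`. [folklore] -/
def partsK34L505_120 : List (ℕ × ℕ × ℤ) := [(0, 32, -7308026781647617375648455279147207816), (32, 9, 7308026781647617375648455279147207816)]

/-- the ranges tile `[0, n_F]` and the claims sum to `≥ 0`. [folklore] -/
theorem pcov_120 : PointKernel.partsOK 40 partsK34L505_120 = true := by
  decide +kernel

/-- levels `[0, 32)` of segment 120: partial lower sum `≥` claim. [folklore] -/
theorem part_120_0 : certK34L505.hPartOK (PCert.segAt hsegsK34L505 120) JHK34L505 0 32 (-7308026781647617375648455279147207816) = true := by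
  decide +kernel

/-- levels `[32, 41)` of segment 120: partial lower sum `≥` claim. [folklore] -/
theorem part_120_1 : certK34L505.hPartOK (PCert.segAt hsegsK34L505 120) JHK34L505 32 9 (7308026781647617375648455279147207816) = true := by
  decide +kernel

/-- one-cell segment 121 (row 6, cell `[903/128, 113/16]`, chord, `n_F = 40`,
2 level ranges): side conditions. [folklore] -/
theorem pside_121 : certK34L505.hPartSideOK (PCert.segAt hsegsK34L505 121) JHK34L505 = true := by
  decide +kernel

/-- its level ranges `(n_lo, count, claim)`. [folklore] -/
def partsK34L505_121 : List (ℕ × ℕ × ℤ) := [(0, 32, -6089849019643716574621905872058241697), (32, 9, 6089849019643716574621905872058241697)]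

/-- the ranges tile `[0, n_F]` and the claims sum to `≥ 0`. [folklore] -/
theorem pcov_121 : PointKernel.partsOK 40 partsK34L505_121 = true := by
  decide +kernel

end Literature.MathematicalPhysics.QuantumFieldTheory.ConformalBootstrap3D.PointKernelK34L505
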